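import Literature.NumberTheory.Automorphic.Sweep1PotentialModularityGoodReductionProofs
import Literature.NumberTheory.EllipticCurves.HasseWeilGoodReductionFrobenius
import HarnessLib

/-!
# lang.S28 (`Sweep1` form) from the source, the Weil pairing and the Frobenius at good places

`Proofs` companion (theorems only) of `Literature.NumberTheory.Automorphic.Sweep1` for the named
fact `Literature.NumberTheory.Automorphic.exists_isCMField_isModular` (**lang.S28**: an elliptic curve without geometric CM
over a CM field becomes modular over a finite CM extension; Allen–Calegari–Caraiani–Gee–Helm–
Le Hung–Newton–Scholze–Taylor–Thorne, *Potential automorphy over CM fields*, Ann. of Math. 197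
(2023), Thm. 1.0.1), continuing `Sweep1PotentialModularity`, `Sweep1PotentialModularityProofs`
and `Sweep1PotentialModularityGoodReductionProofs` (same tenured seat).  The last of these reduced
lang.S28 to the source in Galois form (ACC+ Cor. 7.1.12 for `R_E`: over a finite Galois CM
extension `F'/F`, `E ×_F F'` is Tate-automorphic — an explicit hypothesis `hACC` below, the
statement of the former named fact `exists_isCMField_isTateAutomorphic`, merged back into the
obligation `exists_isCMField_isModular` by the review of 2026-08-15, D-0026) and the Euler factors
of `V_ℓ E` at the places `v ∤ ℓ` of good reduction
(`WeierstrassCurve.hasseWeilEulerFactor_of_hasGoodReduction`).  The elliptic-curve files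
`GoodReductionUnramifiedProofs` (Silverman VII.4.1(b) **proved**: `V_ℓ E` is unramified at the
good places) and `HasseWeilGoodReductionFrobenius` (trace `a_v` and determinant `q_v` of
Frobenius, Silverman C.21 Remark 21.3; the determinant **proved** from the Weil pairing; the trace
reduced to the reduction isomorphism `T_ℓ E ≅ T_ℓ Ẽ_v` and V.2.3.1) decompose those Euler
factors further; this file records the resulting dependency statements for lang.S28:

* `exists_isCMField_isModular_of_isTateAutomorphic_of_frobenius`: lang.S28 from the source and
  Silverman C.21 Remark 21.3 (trace and determinant of Frobenius on `T_ℓ E` at the good places,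
  for all elliptic curves over number fields, at one prime `ℓ`);
* `exists_isCMField_isModular_of_isTateAutomorphic_of_weilPairing`: lang.S28 from the source,
  the Weil pairings on `E[ℓⁿ]` (Silverman Prop. III.8.1) and the trace fact;
* `exists_isCMField_isModular_of_facts`: lang.S28 from the source, the Weil pairings, the
  Frobenius-equivariant reduction isomorphisms `T_ℓ E ≅ T_ℓ Ẽ_v`
  (`galoisRepTate_frobenius_conj_reductionAt`; Silverman VII.3.1(b)/VII.4.1, Diamond–Shurman
  Thm. 9.4.1) and the trace of Frobenius on the Tate module of elliptic curves over finite fields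
  (`trace_galoisRepTate_frobenius`, Silverman Thm. V.2.3.1).

## References

* [AllenCalegariCaraianiGeeEtAl2023] P. B. Allen, F. Calegari, A. Caraiani, T. Gee, D. Helm,
  B. V. Le Hung, J. Newton, P. Scholze, R. Taylor, J. A. Thorne, *Potential automorphy over CM
  fields*, Ann. of Math. (2) 197 (2023), 897–1113: Thm. 1.0.1, §7.1, Cor. 7.1.12.
* [SilvermanAEC2009] J. H. Silverman, *The Arithmetic of Elliptic Curves*, 2nd ed., GTM 106
  (2009): Prop. III.8.1, Thm. V.2.3.1, Prop. VII.4.1, C.§16, C.21 Remark 21.3.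
* [DiamondShurman2005] F. Diamond, J. Shurman, *A First Course in Modular Forms* (2005),
  Thm. 9.4.1.

## Design

No definitions; universe-`0` number fields (`{K : Type}`) as in `Sweep1`; the hypotheses are the
named facts quantified over all elliptic curves over number fields (resp. all Weierstrass curves
over all fields for V.2.3.1), the form in which a discharge `theorem X_holds : X` is consumed.
-/

noncomputable section

namespace Literature.NumberTheory.Automorphic

open WeierstrassCurve

/-- **lang.S28 from the source and Silverman C.21 Remark 21.3.**  The Galois-side statement of
the source (ACC+GHLNSTT 2023, Thm. 1.0.1 non-CM case via Cor. 7.1.12; hypothesis `hACC`)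
together with, at one prime `ℓ` and for every elliptic curve over a number field, the trace
`a_v` and determinant `q_v` of an arithmetic Frobenius on `T_ℓ E` at the places `v ∤ ℓ` of good
reduction (`trace_/det_galoisRepTate_frobenius_of_hasGoodReductionAt`, Silverman C.21
Remark 21.3) implies `Literature.NumberTheory.Automorphic.exists_isCMField_isModular`; the unramifiedness of `V_ℓ E` at
those places (Silverman VII.4.1(b)) and everything downstream are theorems
(`hasseWeilEulerFactor_of_hasGoodReduction_of_frobenius`,
`exists_isCMField_isModular_of_isTateAutomorphic_of_hasGoodReduction`).
[cite: AllenCalegariCaraianiGeeEtAl2023, Thm. 1.0.1 (non-CM case), via Cor. 7.1.12]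
[cite: SilvermanAEC2009, C.21 Remark 21.3] -/
theorem exists_isCMField_isModular_of_isTateAutomorphic_of_frobenius (ℓ : ℕ) [Fact ℓ.Prime]
    (hACC : ∀ {F : Type} [Field F] [NumberField F] [NumberField.IsCMField F]
      (W : WeierstrassCurve F) [W.IsElliptic] (_hW : ¬ W.HasCM),
      ∃ (F' : Type) (_ : Field F') (_ : NumberField F') (_ : Algebra F F'),
        NumberField.IsCMField F' ∧ IsGalois F F' ∧ (W.baseChange F').IsTateAutomorphic)
    (htr : ∀ {K : Type} [Field K] [NumberField K] (W : WeierstrassCurve K),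
      W.trace_galoisRepTate_frobenius_of_hasGoodReductionAt ℓ)
    (hdet : ∀ {K : Type} [Field K] [NumberField K] (W : WeierstrassCurve K),
      W.det_galoisRepTate_frobenius_of_hasGoodReductionAt ℓ) :
    exists_isCMField_isModular :=
  exists_isCMField_isModular_of_isTateAutomorphic_of_hasGoodReduction ℓ hACC
    fun W ↦ hasseWeilEulerFactor_of_hasGoodReduction_of_frobenius (htr W) (hdet W)

/-- **lang.S28 from the source, the Weil pairing and the trace of Frobenius.**  As
`exists_isCMField_isModular_of_isTateAutomorphic_of_frobenius`, with the determinant fact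
discharged from the Weil pairings on `E[ℓ^{n+1}]`, `n ≥ 0` (named facts `exists_weilPairing`,
Silverman Prop. III.8.1; `det_galoisRepTate_frobenius_of_hasGoodReductionAt_of_exists_weilPairing`).
[cite: AllenCalegariCaraianiGeeEtAl2023, Thm. 1.0.1 (non-CM case), via Cor. 7.1.12]
[cite: SilvermanAEC2009, C.21 Remark 21.3 and Prop. III.8.1] -/
theorem exists_isCMField_isModular_of_isTateAutomorphic_of_weilPairing (ℓ : ℕ) [Fact ℓ.Prime]
    (hACC : ∀ {F : Type} [Field F] [NumberField F] [NumberField.IsCMField F]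
      (W : WeierstrassCurve F) [W.IsElliptic] (_hW : ¬ W.HasCM),
      ∃ (F' : Type) (_ : Field F') (_ : NumberField F') (_ : Algebra F F'),
        NumberField.IsCMField F' ∧ IsGalois F F' ∧ (W.baseChange F').IsTateAutomorphic)
    (hW : ∀ {K : Type} [Field K] [NumberField K] (W : WeierstrassCurve K) (n : ℕ),
      W.exists_weilPairing (ℓ ^ (n + 1)))
    (htr : ∀ {K : Type} [Field K] [NumberField K] (W : WeierstrassCurve K),
      W.trace_galoisRepTate_frobenius_of_hasGoodReductionAt ℓ) :
    exists_isCMField_isModular :=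
  exists_isCMField_isModular_of_isTateAutomorphic_of_frobenius ℓ hACC htr
    fun W ↦ det_galoisRepTate_frobenius_of_hasGoodReductionAt_of_exists_weilPairing (hW W)

/-- **lang.S28 from the source, the Weil pairing, the reduction isomorphism and V.2.3.1.**  The
Galois-side statement of the source (hypothesis `hACC`), the Weil pairings
(`exists_weilPairing`, Silverman III.8.1), the Frobenius-equivariant reduction isomorphisms
`T_ℓ E ≅ T_ℓ Ẽ_v` at the good places `v ∤ ℓ` (`galoisRepTate_frobenius_conj_reductionAt`,
Silverman VII.3.1(b)/VII.4.1, Diamond–Shurman Thm. 9.4.1) and the trace of Frobenius on the Tate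
module of an elliptic curve over a finite field (`trace_galoisRepTate_frobenius`, Silverman
Thm. V.2.3.1) imply `Literature.NumberTheory.Automorphic.exists_isCMField_isModular`
(`hasseWeilEulerFactor_of_hasGoodReduction_of_facts`).
[cite: AllenCalegariCaraianiGeeEtAl2023, Thm. 1.0.1 (non-CM case), via Cor. 7.1.12]
[cite: SilvermanAEC2009, Prop. III.8.1, Thm. V.2.3.1, Prop. VII.4.1 and C.21 Remark 21.3] -/
theorem exists_isCMField_isModular_of_facts (ℓ : ℕ) [Fact ℓ.Prime]
    (hACC : ∀ {F : Type} [Field F] [NumberField F] [NumberField.IsCMField F]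
      (W : WeierstrassCurve F) [W.IsElliptic] (_hW : ¬ W.HasCM),
      ∃ (F' : Type) (_ : Field F') (_ : NumberField F') (_ : Algebra F F'),
        NumberField.IsCMField F' ∧ IsGalois F F' ∧ (W.baseChange F').IsTateAutomorphic)
    (hW : ∀ {K : Type} [Field K] [NumberField K] (W : WeierstrassCurve K) (n : ℕ),
      W.exists_weilPairing (ℓ ^ (n + 1)))
    (hconj : ∀ {K : Type} [Field K] [NumberField K] (W : WeierstrassCurve K),
      W.galoisRepTate_frobenius_conj_reductionAt ℓ)
    (htr : ∀ {k : Type} [Field k] (C : WeierstrassCurve k), C.trace_galoisRepTate_frobenius ℓ) :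
    exists_isCMField_isModular :=
  exists_isCMField_isModular_of_isTateAutomorphic_of_hasGoodReduction ℓ hACC
    fun W ↦ hasseWeilEulerFactor_of_hasGoodReduction_of_facts (hW W) (hconj W) fun _ ↦ htr _

end Literature.NumberTheory.Automorphic
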